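import Mathlib.Analysis.Complex.Basic
import Mathlib.Data.Fintype.Perm
import Literature.Computability.AlgebraicComplexity.PermanentIrreducible
import Summits.ValiantsHypothesis.ValiantsHypothesis.Theses.OneNatPerBit
import HarnessLib

/-!
# Route OneNatPerBit — `PerSelfCorrelation` (item stmt-ValiantsHypothesis-10323)

The normalisation anchor `corr²(per_n, per_n) = 1` of the correlation functional of route
`OneNatPerBit`, in the two halves the route file states:

* `Σ_σ coeff_{x_σ} per_n = n!` — every permutation monomial has coefficient `1` in the permanent
  (`coeff_permMonomial_perPoly`), and there are `n!` permutations;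
* `Σ_{m ∈ supp per_n} ‖coeff_m per_n‖² = n!` — the support of `per_n` is the injective image of
  `S_n` under `permMonomial`, and every coefficient there is `1`.

Everything is elementary bookkeeping on top of
`Literature/Computability/AlgebraicComplexity/PermanentIrreducible.lean`.
-/

-- `Summit.ValiantsHypothesis.ValiantsHypothesis.…` is the tree's mandated single-conjunct layout
-- (Sub = Summit), so the duplicated namespace component is intended.
set_option linter.dupNamespace false

namespace Summit.ValiantsHypothesis.ValiantsHypothesis.Theorems.OneNatPerBit

open Literature.Computability.AlgebraicComplexity MvPolynomial

/-- The permutation-monomial coefficient mass of the permanent: `Σ_σ coeff_{x_σ} per_n = n!`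
(each coefficient is `1`, `coeff_permMonomial_perPoly`, and `|S_n| = n!`). -/
theorem sum_coeff_permMonomial_perPoly (n : ℕ) :
    (∑ σ : Equiv.Perm (Fin n), coeff (permMonomial σ) (perPoly (Fin n) ℂ)) = (n.factorial : ℂ) := by
  simp only [coeff_permMonomial_perPoly, Finset.sum_const, Finset.card_univ, Fintype.card_perm,
    Fintype.card_fin, nsmul_eq_mul, mul_one]

/-- The support of the permanent is the (injective) image of `S_n` under `permMonomial`. -/
theorem support_perPoly_eq_image (n : ℕ) :
    (perPoly (Fin n) ℂ).support = Finset.univ.image permMonomial := by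
  ext m
  simp only [Finset.mem_image, Finset.mem_univ, true_and, mem_support_iff]
  constructor
  · intro h
    exact exists_permMonomial_eq_of_coeff_perPoly_ne_zero ℂ h
  · rintro ⟨σ, rfl⟩
    rw [coeff_permMonomial_perPoly]
    exact one_ne_zero

/-- The squared `ℓ²` coefficient norm of the permanent: `Σ_{m ∈ supp per_n} ‖coeff_m per_n‖² = n!`. -/
theorem sum_support_norm_coeff_sq_perPoly (n : ℕ) :
    (perPoly (Fin n) ℂ).support.sum (fun m => ‖coeff m (perPoly (Fin n) ℂ)‖ ^ 2) =
      (n.factorial : ℝ) := by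
  rw [support_perPoly_eq_image, Finset.sum_image (fun σ _ τ _ h => permMonomial_injective h)]
  simp only [coeff_permMonomial_perPoly, norm_one, one_pow, Finset.sum_const, Finset.card_univ,
    Fintype.card_perm, Fintype.card_fin, nsmul_eq_mul, mul_one]

/-- **Item stmt-ValiantsHypothesis-10323** (`PerSelfCorrelation`, route OneNatPerBit): the
normalisation anchor `corr²(per_n, per_n) = 1`, i.e. `Σ_σ coeff_{x_σ} per_n = n!` and
`Σ_{m ∈ supp} ‖coeff_m per_n‖² = n!`. -/
theorem perSelfCorrelation_proof :
    Summit.ValiantsHypothesis.ValiantsHypothesis.Theses.OneNatPerBit.PerSelfCorrelation := by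
  unfold Summit.ValiantsHypothesis.ValiantsHypothesis.Theses.OneNatPerBit.PerSelfCorrelation
  intro n
  exact ⟨sum_coeff_permMonomial_perPoly n, sum_support_norm_coeff_sq_perPoly n⟩

end Summit.ValiantsHypothesis.ValiantsHypothesis.Theorems.OneNatPerBit
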